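import Summits.ResolutionOfSingularities.ResolutionOfSingularities.Theorems.PurelyInseparableDim4Target
import Literature.AlgebraicGeometry.Resolution.CentreBlowupOrdAlongBasics
import Literature.AlgebraicGeometry.Resolution.CentreBlowupMohStability
import Literature.AlgebraicGeometry.Resolution.OrdZeroBasics
import HarnessLib

/-!
# Purely inseparable fourfolds — STEP KIT (1/3): a kernel-evaluable mirror of `CentreBlowup.step`
# with exact transfer theorems (cell `res-dim4-pi`, WAVE3 row W3-2 «cert-1»)

[OURS · counted 0 · instrument] Nothing here is a statement about resolution of singularities.
The cell's located facts (literal cycles of a centre rule, traps, rise edges) are certified as theorems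
about the TREE's `CentreBlowup.step / IsEquimultiplePoint / ordAlong` and `PIDim4.Step1h / Edge / IsTrap`
(pattern `Mode1hTwoCycle.not_terminates1h_two`, ≈ 400 lines per 2-cycle).  This module makes them
mechanical: `F ∈ K[x₁,…,xₙ]` is PRESENTED as a list of terms `(e, c)`, `e : Fin n → ℕ` (written
`![a,b,c,d]`), `c : K`, read into `MvPolynomial (Fin n) K` by `evalT`; the chart transform, the
translation `xᵢ ↦ xᵢ + bᵢ` (binomial theorem, one variable at a time over `List.finRange n`), the
deletion of `q`-th-power monomials and the coefficient / support / `ordAlong` / `ord₀` queries are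
re-implemented on term lists by structural recursion and proved EQUAL to the tree's operations
(`chartTransform_evalT`, `translate_evalT`, `deletePthPowers_evalT`, `coeff_evalT`, `ordAlong_evalT`,
`ordZero_evalT`, `evalT_eq_iff_equivB`), so that `decide` (kernel evaluation, no `native_decide`)
settles them on explicit data; no normal form is required of the lists.  Part 2
(`PurelyInseparableDim4StepKitTranslate`) is the translation, part 3 (`PurelyInseparableDim4StepKitState`)
adds presented states, `step`, and the cell's predicates.
bears_on: LADDER-RESOLUTION:D157-DOOR2 (res-dim4-pi · W3-2). Supports stmt-ResolutionOfSingularities-16155 (helper).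
-/

set_option linter.dupNamespace false -- mandated namespace of this single-conjunct summit

noncomputable section

open MvPolynomial Finset

open scoped BigOperators

namespace Summit.ResolutionOfSingularities.ResolutionOfSingularities.Theorems.PIDim4

namespace StepKit

open Literature.AlgebraicGeometry.Resolution
open Literature.AlgebraicGeometry.Resolution.CentreBlowup
open Literature.AlgebraicGeometry.Resolution.Hauser2010

variable {n : ℕ} {R : Type*} [CommRing R]

/-! ## §1 Exponent functions and term lists -/

/-- The exponent function `e : Fin n → ℕ` read as a finitely supported exponent. [folklore] -/
def expo (e : Fin n → ℕ) : Fin n →₀ ℕ := Finsupp.equivFunOnFinite.symm e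

/-- `expo e` has the values of `e`. [folklore] -/
@[simp] theorem expo_apply (e : Fin n → ℕ) (i : Fin n) : expo e i = e i := rfl

/-- Every exponent is `expo` of its value function. [folklore] -/
theorem expo_coe (d : Fin n →₀ ℕ) : expo (⇑d) = d := Finsupp.ext fun _ => rfl

/-- `expo` is injective. [folklore] -/
theorem expo_inj {e e' : Fin n → ℕ} : expo e = expo e' ↔ e = e' := by
  constructor
  · intro h; funext i; have := congrArg (fun d => d i) h; simpa using this
  · rintro rfl; rfl

/-- `expo e = d` iff `e` is the value function of `d`. [folklore] -/
theorem expo_eq_iff {e : Fin n → ℕ} {d : Fin n →₀ ℕ} : expo e = d ↔ e = ⇑d := by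
  rw [← expo_coe d, expo_inj, expo_coe]

/-- `S`-degree of `expo e`. [folklore] -/
theorem degIn_expo (S : Finset (Fin n)) (e : Fin n → ℕ) : degIn S (expo e) = ∑ i ∈ S, e i := rfl

/-- Total degree of `expo e`. [folklore] -/
theorem degree_expo (e : Fin n → ℕ) : (expo e).degree = ∑ i, e i := by
  rw [← degIn_univ]; rfl

/-- `expo e = 0` iff `e = 0`. [folklore] -/
theorem expo_eq_zero_iff (e : Fin n → ℕ) : expo e = 0 ↔ e = 0 := by
  rw [show (0 : Fin n →₀ ℕ) = expo 0 from (expo_coe 0).symm, expo_inj]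

/-- A term list: pairs (exponent function, coefficient). [folklore] -/
abbrev Terms (n : ℕ) (R : Type*) : Type _ := List ((Fin n → ℕ) × R)

/-- The polynomial presented by a term list: `Σ c · x^e`. [folklore] -/
def evalT : Terms n R → MvPolynomial (Fin n) R
  | [] => 0
  | t :: L => monomial (expo t.1) t.2 + evalT L

/-- `evalT [] = 0`. [folklore] -/
@[simp] theorem evalT_nil : evalT ([] : Terms n R) = 0 := rfl

/-- `evalT` of a cons. [folklore] -/
@[simp] theorem evalT_cons (t : (Fin n → ℕ) × R) (L : Terms n R) :
    evalT (t :: L) = monomial (expo t.1) t.2 + evalT L := rfl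

/-- `evalT` is additive in the list. [folklore] -/
theorem evalT_append (L L' : Terms n R) : evalT (L ++ L') = evalT L + evalT L' := by
  induction L with
  | nil => simp
  | cons t L ih => rw [List.cons_append, evalT_cons, evalT_cons, ih, add_assoc]

/-- `evalT` of a mapped list as a list sum. [folklore] -/
theorem evalT_eq_sum (L : Terms n R) : evalT L = (L.map fun t => monomial (expo t.1) t.2).sum := by
  induction L with
  | nil => rfl
  | cons t L ih => rw [evalT_cons, List.map_cons, List.sum_cons, ih]

/-! ## §2 Coefficients, equality, support -/

/-- The coefficient of `x^e` in the presented polynomial, computed on the list (duplicates add up). [folklore] -/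
def coeffAt : Terms n R → (Fin n → ℕ) → R
  | [], _ => 0
  | t :: L, e => (if t.1 = e then t.2 else 0) + coeffAt L e

/-- **Transfer of coefficients.** [folklore] -/
theorem coeff_evalT (L : Terms n R) (d : Fin n →₀ ℕ) : coeff d (evalT L) = coeffAt L ⇑d := by
  induction L with
  | nil => simp [coeffAt]
  | cons t L ih =>
    rw [evalT_cons, coeff_add, coeff_monomial, ih, coeffAt]
    congr 1
    by_cases h : t.1 = ⇑d
    · rw [if_pos h, if_pos (expo_eq_iff.mpr h)]
    · rw [if_neg h, if_neg (mt expo_eq_iff.mp h)]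

/-- Coefficient at `expo e`. [folklore] -/
theorem coeff_expo_evalT (L : Terms n R) (e : Fin n → ℕ) : coeff (expo e) (evalT L) = coeffAt L e :=
  coeff_evalT L (expo e)

/-- An exponent absent from the list has coefficient `0`. [folklore] -/
theorem coeffAt_eq_zero_of_forall_ne {L : Terms n R} {e : Fin n → ℕ} (h : ∀ t ∈ L, t.1 ≠ e) :
    coeffAt L e = 0 := by
  induction L with
  | nil => rfl
  | cons t L ih =>
    rw [coeffAt, if_neg (h t (by simp)), zero_add]
    exact ih fun t' ht' => h t' (by simp [ht'])

/-- A non-zero coefficient comes from an exponent present in the list. [folklore] -/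
theorem exists_mem_of_coeffAt_ne_zero {L : Terms n R} {e : Fin n → ℕ} (h : coeffAt L e ≠ 0) :
    ∃ t ∈ L, t.1 = e := by
  by_contra hne
  exact h (coeffAt_eq_zero_of_forall_ne fun t ht hte => hne ⟨t, ht, hte⟩)

section Dec

variable [DecidableEq R]

/-- **Equality test**: the two lists present the same polynomial iff their coefficients agree at every
exponent occurring in either list. [folklore] -/
def equivB (L L' : Terms n R) : Bool :=
  (L ++ L').all fun t => decide (coeffAt L t.1 = coeffAt L' t.1)

/-- **Transfer of equality.** [folklore] -/
theorem evalT_eq_iff_equivB (L L' : Terms n R) : evalT L = evalT L' ↔ equivB L L' = true := by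
  constructor
  · intro h
    simp only [equivB, List.all_eq_true, decide_eq_true_eq]
    intro t _
    rw [← coeff_expo_evalT, ← coeff_expo_evalT, h]
  · intro h
    simp only [equivB, List.all_eq_true, decide_eq_true_eq, List.mem_append] at h
    ext d
    rw [coeff_evalT, coeff_evalT]
    by_cases hd : ∃ t ∈ L ++ L', t.1 = ⇑d
    · obtain ⟨t, ht, hte⟩ := hd
      rw [← hte]; exact h t (List.mem_append.mp ht)
    · rw [coeffAt_eq_zero_of_forall_ne fun t ht hte => hd ⟨t, List.mem_append_left _ ht, hte⟩,
        coeffAt_eq_zero_of_forall_ne fun t ht hte => hd ⟨t, List.mem_append_right _ ht, hte⟩]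

/-- **Zero test.** [folklore] -/
theorem evalT_eq_zero_iff (L : Terms n R) : evalT L = 0 ↔ equivB L [] = true := by
  rw [← evalT_eq_iff_equivB]; rfl

/-- The **live exponents**: those occurring in the list with non-zero total coefficient. [folklore] -/
def live (L : Terms n R) : List (Fin n → ℕ) := (L.map Prod.fst).filter fun e => coeffAt L e ≠ 0

/-- **Transfer of the support**: `d` is in the support iff its value function is live. [folklore] -/
theorem mem_support_evalT_iff (L : Terms n R) (d : Fin n →₀ ℕ) :
    d ∈ (evalT L).support ↔ ⇑d ∈ live L := by
  rw [MvPolynomial.mem_support_iff, coeff_evalT, live, List.mem_filter, List.mem_map, decide_eq_true_eq]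
  constructor
  · intro h
    obtain ⟨t, ht, hte⟩ := exists_mem_of_coeffAt_ne_zero h
    exact ⟨⟨t, ht, hte⟩, h⟩
  · exact fun h => h.2

/-- `expo e` is in the support iff `e` is live. [folklore] -/
theorem expo_mem_support_iff (L : Terms n R) (e : Fin n → ℕ) : expo e ∈ (evalT L).support ↔ e ∈ live L :=
  mem_support_evalT_iff L (expo e)

/-- Minimum of a list in `ℕ∞` (`⊤` for the empty list). [folklore] -/
def infList : List ℕ → ℕ∞
  | [] => ⊤
  | a :: l => min (a : ℕ∞) (infList l)

/-- `infList l ≤ a` for `a ∈ l`. [folklore] -/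
theorem infList_le {l : List ℕ} {a : ℕ} (h : a ∈ l) : infList l ≤ a := by
  induction l with
  | nil => simp at h
  | cons b l ih =>
    rw [infList]
    rcases List.mem_cons.mp h with rfl | h
    · exact min_le_left _ _
    · exact le_trans (min_le_right _ _) (ih h)

/-- `m ≤ infList l` iff `m` bounds every entry from below. [folklore] -/
theorem le_infList_iff {l : List ℕ} {m : ℕ∞} : m ≤ infList l ↔ ∀ a ∈ l, m ≤ a := by
  induction l with
  | nil => simp [infList]
  | cons b l ih => simp [infList, ih]

/-- **Transfer of `ordAlong`**: the order along `V(x_S)` is the least `S`-degree of a live exponent.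
[folklore] -/
theorem ordAlong_evalT (S : Finset (Fin n)) (L : Terms n R) :
    ordAlong S (evalT L) = infList ((live L).map fun e => ∑ i ∈ S, e i) := by
  apply le_antisymm
  · rw [le_infList_iff]
    intro a ha
    obtain ⟨e, he, rfl⟩ := List.mem_map.mp ha
    have := ordAlong_le_of_mem_support (S := S) ((expo_mem_support_iff L e).mpr he)
    rwa [degIn_expo] at this
  · rw [le_ordAlong_iff]
    intro d hd
    rw [← expo_coe d, degIn_expo]
    exact infList_le (List.mem_map.mpr ⟨⇑d, (mem_support_evalT_iff L d).mp hd, rfl⟩)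

end Dec

/-! ## §3 The chart transform -/

/-- The chart law on exponent functions: `e_j ↦ Σ_{i∈S} e_i − q`, other entries kept. [folklore] -/
def chartE (q : ℕ) (S : Finset (Fin n)) (j : Fin n) (e : Fin n → ℕ) : Fin n → ℕ :=
  Function.update e j ((∑ i ∈ S, e i) - q)

/-- `chartE` is the tree's `chartExponent` on value functions. [folklore] -/
theorem expo_chartE (q : ℕ) (S : Finset (Fin n)) (j : Fin n) (e : Fin n → ℕ) :
    expo (chartE q S j e) = chartExponent q S j (expo e) := by
  ext i
  rw [expo_apply, chartE, chartExponent_apply, degIn_expo, Function.update_apply, expo_apply]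

/-- The chart transform on term lists. [folklore] -/
def chartL (q : ℕ) (S : Finset (Fin n)) (j : Fin n) (L : Terms n R) : Terms n R :=
  L.map fun t => (chartE q S j t.1, t.2)

/-- **Transfer of the chart transform.** [folklore] -/
theorem chartTransform_evalT (q : ℕ) (S : Finset (Fin n)) (j : Fin n) (L : Terms n R) :
    chartTransform q S j (evalT L) = evalT (chartL q S j L) := by
  induction L with
  | nil => simp [chartL, chartTransform_zero]
  | cons t L ih =>
    simp only [chartL, List.map_cons, evalT_cons] at ih ⊢
    rw [chartTransform_add, chartTransform_monomial, ih, expo_chartE]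

/-! ## §4 Deleting `q`-th power monomials -/

/-- Cleaning on term lists: drop the terms whose exponent is divisible by `q` entrywise. [folklore] -/
def cleanL (q : ℕ) (L : Terms n R) : Terms n R := L.filter fun t => !decide (∀ i, q ∣ t.1 i)

/-- `expo e` is a `q`-th power exponent iff `q ∣ e i` for all `i`. [folklore] -/
theorem isPthPowerExponent_expo_iff (q : ℕ) (e : Fin n → ℕ) : IsPthPowerExponent q (expo e) ↔ ∀ i, q ∣ e i := by
  rw [isPthPowerExponent_iff]; rfl

/-- **Transfer of cleaning.** [folklore] -/
theorem deletePthPowers_evalT (q : ℕ) (L : Terms n R) : deletePthPowers q (evalT L) = evalT (cleanL q L) := by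
  induction L with
  | nil => simp [cleanL, deletePthPowers_zero]
  | cons t L ih =>
    simp only [cleanL, List.filter_cons] at ih ⊢
    rw [evalT_cons, deletePthPowers_add, deletePthPowers_monomial, ih]
    by_cases h : ∀ i, q ∣ t.1 i
    · rw [if_pos ((isPthPowerExponent_expo_iff q t.1).mpr h), zero_add]
      simp [h]
    · rw [if_neg (mt (isPthPowerExponent_expo_iff q t.1).mp h)]
      simp [h]

/-! ## §6 Order at the origin -/

/-- **Transfer of `ord₀`** (over a field): the least total degree of a live exponent. [folklore] -/
theorem ordZero_evalT {K : Type*} [Field K] [DecidableEq K] (L : Terms n K) :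
    ordZero (evalT L) = infList ((live L).map fun e => ∑ i, e i) := by
  rw [← ordAlong_univ, ordAlong_evalT]

end StepKit

end Summit.ResolutionOfSingularities.ResolutionOfSingularities.Theorems.PIDim4

end
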